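import Summits.BirchSwinnertonDyer.BirchSwinnertonDyer.Theorems.ManinLocalTwoThreeManinPrimeToAdditiveFiveLeTypeIIAtFiveCornerOfUnstarredLaw
import Summits.BirchSwinnertonDyer.BirchSwinnertonDyer.Theorems.ManinLocalTwoThreeManinPrimeToAdditiveFiveLeUnstarredLawOfAcrossIsogeny
import Summits.BirchSwinnertonDyer.BirchSwinnertonDyer.Theorems.ManinLocalTwoThreeManinPrimeToAdditiveFiveLeUpperAnchorOfFacts
import Summits.BirchSwinnertonDyer.BirchSwinnertonDyer.Theorems.ManinLocalTwoThreeManinPrimeToAdditiveFiveLeDegreeUpSevenOfOrdinaryTwistLaw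
import HarnessLib

/-!
# Route `ManinLocalTwoThree`, residual crux C5 `ManinPrimeToAdditiveFiveLe`
# (stmt-BirchSwinnertonDyer-22969), line `upper_anchor` (skeleton v11, stub `stub_ss57` = K15b stmt-27071 BY NAME):
# **on the potentially SUPERSINGULAR Raynaud rows (5; IV), (7; III) the ramified twist `W ⊗ p*` is NEVER `X₀`-optimal —
# the orbit cannot commute — granted ONE Manin-free law («optimal ⟹ unstarred», (U) = E-imc-5 at 5, 7 + Gealy–Klagsbrun)**

Lead seat bsd-line-ml23-c5-p1 (gen 6). Kernel certificate behind the lead's EDIXHOVEN READING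
(`Cruxes/ManinPrimeToAdditiveFiveLe/Lines/upper-anchor-edixhoven-reading.md`): Edixhoven's printed §4 dichotomy (typescript
ll. 611–646: «Since `Λ̃` is proportional to `Λ` …», case 1 / case 2 with `deg φ̃ = p^{∓1}·deg φ`) presupposes that the strong
curve of the `χ_{p*}`-twisted class IS a model of `W ⊗ p*` (a COMMUTING optimal orbit). On the rows of K15b
(`TwistFamilyManinDescent.SupersingularUnstarredStrongManinUnit`, stmt-27071) — `W[p]`-reducible, `(p; ord_p Δ_min) ∈ {(5;4), (7;3)}`,
potentially supersingular — Cremona's table shows the OPPOSITE: all 771 + 122 orbits FLIP. THIS FILE proves the structural reason,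
modulo the line's ONE orientation law:

* `ssRow_smul_twist_ne_optimal_of_optimalUnstarredNonGord` — **(U) ⟹ for `W` globally minimal on a K15b row with the line's cuts
  (odd/dyadic twist-minimality, `W[p]` reducible, `N > 5·10⁵`, no `Iₙ*` fibre), NO globally minimal model `u • (W ⊗ p*)` carries a
  lattice-optimal conductor-level datum.** Proof (the argument of μ p623176 on these rows): such a model `W₀` has
  `ord_p Δ_min(W₀) = ord_p Δ_min(W) + 6 ∈ {10, 9}` (`padicValInt_minimalDiscriminantInt_twist_pm_p_of_lt_six`), tame index
  `12 / gcd(12, ·) = 6` resp. `4`, which does not divide `p − 1 = 4` resp. `6`; so `W₀` is not (G) (uniform dictionary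
  `subGord_iff_typeG_of_addv`), a fortiori not (G)-ordinary; the cuts transfer to `W₀` (`p² ∣ N(W₀) = N(W)` by twist-minimality
  and `conductorNorm_eq_of_isIsogenous_twist_pStar_of_sq_dvd`; reducibility, twist-minimality by the θ transports; no `Iₙ*` since
  `j(W₀) = j(W)` is `p`-integral); and (U) applied to `(W₀, D₀)` says `ord_p Δ_min(W₀) ≤ 4` — contradiction.
* `ssRow_smul_twist_ne_optimal_of_acrossIsogeny` — the same from the planner-of-record's registered conjecture E-imc-5
  `OptimalUnstarredAcrossIsogeny 5 ∧ 7` and Gealy–Klagsbrun 2017 Thm. 1 (cite-only), via the width seat's υ (p626338).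

CONSEQUENCE (with the an-cell's PROVED trichotomy `pStar_optimal_orbit_trichotomy_full`, not re-derived here): on K15b's rows the
optimal `χ_{p*}`-orbit is in case (iii) — `deg φ̃ = deg φ`, `Ẽ ≄ W ⊗ p*` — so the printed case-1/case-2 analysis never applies
there; K15b's printed route is Prop. 7 (`e < p − 1`) + the parity lemma read directly on `φ` + Prop. 8 (memo §3). Census: 771 + 771
flip rows at 5, 122 at 7, 0 commuting (HOME data/TWISTCENSUS2, N ≤ 5·10⁵).

HONEST STATUS. Conditional results (`--supports`, helper) on OPEN Manin-free laws ((U); E-imc-5 REF1 SURVIVES 2026-08-27) and one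
cite-only fact (GK); no Manin constant occurs in the statements. Nothing here proves K15b, C5, E-imc-5, Manin's conjecture or BSD.

References: [EdixhovenManin1991] §4 (typescript ll. 611–646, 703–710); [Stevens1989] §2; [GealyKlagsbrun2017] Thm. 1;
[SerreTate1968] §2 Cor. 3; [SilvermanATAEC1994] IV Table 4.1; [Delbourgo1998] §1.5 (hypothesis (G)); [SilvermanAEC2009] VII.5 Prop. 5.1.
-/

set_option autoImplicit false
-- the Theorems namespace of this sub repeats the summit name by design (D-0017 nested layout)
set_option linter.dupNamespace false

noncomputable section

open scoped Classical NumberField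

namespace Summit.BirchSwinnertonDyer.BirchSwinnertonDyer.Theorems

open WeierstrassCurve IsDedekindDomain IsDedekindDomain.HeightOneSpectrum Rat.HeightOneSpectrum NumberField
  Literature.NumberTheory.EllipticCurves Literature.NumberTheory.EllipticCurves.ModularForms
  Literature.NumberTheory.EllipticCurves.Rank1Residual
  Literature.NumberTheory.DiophantineGeometry
  Summit.BirchSwinnertonDyer.Rank1Residual.ManinAdditive
  Summit.BirchSwinnertonDyer.Rank1Residual.Additive

/-- **(U) ⟹ on the K15b rows `(5; IV)`, `(7; III)` the ramified twist `W ⊗ p*` has no `X₀`-optimal globally minimal model**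
(`hU` = the law «optimal ⟹ unstarred on the non-(G)-ordinary `W[p]`-reducible locus at `p ∈ {5, 7}`», hypothesis of μ p623176,
VERBATIM). For `W` globally minimal with `p² ∣ N(W) > 5·10⁵`, the line's twist-minimality cuts, `W[p]` reducible, no `Iₙ*` fibre and
`(p; ord_p Δ_min) ∈ {(5;4), (7;3)}`: every globally minimal `W₀ = u • (W ⊗ p*)` with a lattice-optimal conductor-level datum is
impossible (it would be starred of tame index `∤ p − 1`, and (U) forbids it). Conditional result between OPEN statements; no Manin
constant involved. [cite: Stevens1989, §2] [cite: SilvermanATAEC1994, IV Table 4.1] [cite: Delbourgo1998, §1.5] -/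
theorem ssRow_smul_twist_ne_optimal_of_optimalUnstarredNonGord
    (hU : exists_isNewformOf →
      ∀ (W : WeierstrassCurve ℚ) [W.IsElliptic] [W.IsGloballyMinimal] [NeZero (W.conductorNorm ℤ)]
        (D : ModularParametrizationData W (W.conductorNorm ℤ)),
        IsLatticeOptimal D → ∀ (p : ℕ) (hp : p.Prime), (p = 5 ∨ p = 7) → p ^ 2 ∣ W.conductorNorm ℤ →
        ¬ (∃ (W' : WeierstrassCurve ℚ) (q : ℕ), W'.IsElliptic ∧ W'.IsGloballyMinimal ∧ q.Prime ∧
            q ≠ 2 ∧ q ^ 2 ∣ W.conductorNorm ℤ ∧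
            IsIsogenous W (W'.quadraticTwist (((-1 : ℤ) ^ (q / 2) * q : ℤ) : ℚ)) ∧
            ¬ q ^ 2 ∣ W'.conductorNorm ℤ) →
        ¬ (∃ (W' : WeierstrassCurve ℚ) (d : ℤ), W'.IsElliptic ∧ W'.IsGloballyMinimal ∧
            (d = -1 ∨ d = 2 ∨ d = -2) ∧ 2 ^ 2 ∣ W.conductorNorm ℤ ∧
            IsIsogenous W (W'.quadraticTwist (d : ℚ)) ∧ ¬ 2 ^ 2 ∣ W'.conductorNorm ℤ) →
        ¬ W.HasIrreducibleModPGaloisRep p →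
        500000 < W.conductorNorm ℤ →
        (∀ n : ℕ, W.kodairaSymbolAt ((Rat.HeightOneSpectrum.primesEquiv (R := ℤ)).symm ⟨p, hp⟩) ≠
          .Istar n) →
        ¬ TypeGOrd W p →
        padicValInt p W.minimalDiscriminantInt ≤ 4) :
    exists_isNewformOf →
    ∀ (W : WeierstrassCurve ℚ) [W.IsElliptic] [W.IsGloballyMinimal] (p : ℕ) (hp : p.Prime),
      (p = 5 ∨ p = 7) → p ^ 2 ∣ W.conductorNorm ℤ →
      ¬ (∃ (W' : WeierstrassCurve ℚ) (q : ℕ), W'.IsElliptic ∧ W'.IsGloballyMinimal ∧ q.Prime ∧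
          q ≠ 2 ∧ q ^ 2 ∣ W.conductorNorm ℤ ∧
          IsIsogenous W (W'.quadraticTwist (((-1 : ℤ) ^ (q / 2) * q : ℤ) : ℚ)) ∧
          ¬ q ^ 2 ∣ W'.conductorNorm ℤ) →
      ¬ (∃ (W' : WeierstrassCurve ℚ) (d : ℤ), W'.IsElliptic ∧ W'.IsGloballyMinimal ∧
          (d = -1 ∨ d = 2 ∨ d = -2) ∧ 2 ^ 2 ∣ W.conductorNorm ℤ ∧
          IsIsogenous W (W'.quadraticTwist (d : ℚ)) ∧ ¬ 2 ^ 2 ∣ W'.conductorNorm ℤ) →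
      ¬ W.HasIrreducibleModPGaloisRep p →
      500000 < W.conductorNorm ℤ →
      (∀ n : ℕ, W.kodairaSymbolAt ((Rat.HeightOneSpectrum.primesEquiv (R := ℤ)).symm ⟨p, hp⟩) ≠
        .Istar n) →
      ((p = 5 ∧ padicValInt p W.minimalDiscriminantInt = 4) ∨
        (p = 7 ∧ padicValInt p W.minimalDiscriminantInt = 3)) →
      ∀ (W₀ : WeierstrassCurve ℚ) [W₀.IsElliptic] [W₀.IsGloballyMinimal] [NeZero (W₀.conductorNorm ℤ)]
        (D₀ : ModularParametrizationData W₀ (W₀.conductorNorm ℤ)), IsLatticeOptimal D₀ →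
        ∀ u : VariableChange ℚ, u • W.quadraticTwist ((((-1 : ℤ) ^ (p / 2) * p : ℤ)) : ℚ) ≠ W₀ := by
  intro hnf W _ _ p hp h57 hpN hodd hdy hred hN hI hcell W₀ _ _ _ D₀ hD₀ u heq
  haveI hpF : Fact p.Prime := ⟨hp⟩
  have h5 : 5 ≤ p := by rcases h57 with rfl | rfl <;> norm_num
  have hp2 : p ≠ 2 := by omega
  obtain ⟨-, hd⟩ := pStar_intCast p
  have hd0 : ((((-1 : ℤ) ^ (p / 2) * p : ℤ)) : ℚ) ≠ 0 := by
    push_cast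
    exact mul_ne_zero (pow_ne_zero _ (by norm_num)) (by exact_mod_cast hp.ne_zero)
  haveI : (W.quadraticTwist ((((-1 : ℤ) ^ (p / 2) * p : ℤ)) : ℚ)).IsElliptic := W.isElliptic_quadraticTwist hd0
  haveI : (W₀.quadraticTwist ((((-1 : ℤ) ^ (p / 2) * p : ℤ)) : ℚ)).IsElliptic := W₀.isElliptic_quadraticTwist hd0
  haveI : ((W.quadraticTwist ((((-1 : ℤ) ^ (p / 2) * p : ℤ)) : ℚ)).quadraticTwist
      ((((-1 : ℤ) ^ (p / 2) * p : ℤ)) : ℚ)).IsElliptic :=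
    (W.quadraticTwist ((((-1 : ℤ) ^ (p / 2) * p : ℤ)) : ℚ)).isElliptic_quadraticTwist hd0
  -- the commuting hypothesis: `W₀` is a model of `W ⊗ p*`
  have hiso : IsIsogenous (W.quadraticTwist ((((-1 : ℤ) ^ (p / 2) * p : ℤ)) : ℚ)) W₀ := by
    rw [← heq]
    exact isIsogenous_smul _ _
  -- `W ∼ W₀ ⊗ p*`
  have htw : IsIsogenous W (W₀.quadraticTwist ((((-1 : ℤ) ^ (p / 2) * p : ℤ)) : ℚ)) := by
    obtain ⟨Cq, hCq⟩ := W.exists_variableChange_smul_eq_quadraticTwist_sq hd0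
    have h1 : IsIsogenous W ((W.quadraticTwist ((((-1 : ℤ) ^ (p / 2) * p : ℤ)) : ℚ)).quadraticTwist
        ((((-1 : ℤ) ^ (p / 2) * p : ℤ)) : ℚ)) := by
      rw [quadraticTwist_quadraticTwist, ← sq, ← hCq]
      exact isIsogenous_smul _ _
    exact h1.trans' (hiso.quadraticTwist hd0)
  -- twist-minimality of `W` at `p`: `p² ∣ N(W₀)`; hence `N(W₀) = N(W)`
  have hpN₀ : p ^ 2 ∣ W₀.conductorNorm ℤ := by
    by_contra h
    exact hodd ⟨W₀, p, inferInstance, inferInstance, hp, hp2, hpN, htw, h⟩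
  have hNN : W₀.conductorNorm ℤ = W.conductorNorm ℤ :=
    conductorNorm_eq_of_isIsogenous_twist_pStar_of_sq_dvd hnf h5 htw hpN hpN₀
  have hadd : Addv W p := not_good_and_not_mult_of_sq_dvd_conductorNorm W hpN
  have hadd₀ : Addv W₀ p := not_good_and_not_mult_of_sq_dvd_conductorNorm W₀ hpN₀
  -- `ord_p Δ_min(W₀) = ord_p Δ_min(W) + 6 ∈ {10, 9}`
  have hv6 : padicValInt p W.minimalDiscriminantInt < 6 := by
    rcases hcell with ⟨-, h⟩ | ⟨-, h⟩ <;> omega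
  have hv₀ : padicValInt p W₀.minimalDiscriminantInt = padicValInt p W.minimalDiscriminantInt + 6 :=
    padicValInt_minimalDiscriminantInt_twist_pm_p_of_lt_six p hp2 W W₀ hv6 hd u heq
  -- `j(W₀) = j(W)` is `p`-integral (no `Iₙ*` fibre for `W`), hence no `Iₙ*` fibre for `W₀` either
  have hjW : 0 ≤ padicValRat p W.j := padicValRat_j_nonneg_of_forall_ne_Istar_placeOf W p hp2 hadd hI
  have hj₀ : 0 ≤ padicValRat p W₀.j := by
    rw [j_eq_of_smul_quadraticTwist_eq hd0 u heq]
    exact hjW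
  have h6 : padicValInt p W₀.minimalDiscriminantInt ≠ 6 := by
    rcases hcell with ⟨-, h⟩ | ⟨-, h⟩ <;> omega
  have hI₀ : ∀ n : ℕ,
      W₀.kodairaSymbolAt ((Rat.HeightOneSpectrum.primesEquiv (R := ℤ)).symm ⟨p, hp⟩) ≠ .Istar n := by
    intro n hK
    have hK' : W₀.kodairaSymbolAt (placeOf p) = .Istar n := hK
    cases n with
    | zero =>
      have h := padicValInt_minimalDiscriminantInt_eq_numComponents_add_one W₀ p h5 hadd₀
      rw [hK', KodairaSymbol.numComponents_Istar] at h
      exact h6 (by omega)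
    | succ k =>
      haveI : PerfectField (IsLocalRing.ResidueField ((placeOf p).adicCompletionIntegers ℚ)) :=
        PerfectField.ofFinite
      have hchar : ringChar (ℤ ⧸ (placeOf p).asIdeal) ≠ 2 := by
        rw [ringChar_int_quot_placeOf p]; omega
      have h1 := one_lt_valuation_j_of_kodairaSymbolAt_eq_Istar_succ (placeOf p) W₀ hchar hK'
      have hj0 : W₀.j ≠ 0 := by
        intro h0
        rw [h0, map_zero] at h1
        exact not_lt.mpr zero_le_one h1
      have hgen : natGenerator (placeOf p) = p :=
        congrArg Subtype.val ((primesEquiv (R := ℤ)).apply_symm_apply ⟨p, hp⟩)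
      rw [Rat.HeightOneSpectrum.valuation_eq_exp_neg_padicValRat (placeOf p) hj0,
        hgen, ← WithZero.exp_zero, WithZero.exp_lt_exp] at h1
      linarith
  -- `W₀` is not (G): tame index `12 / gcd(12, ord_p Δ_min(W₀)) ∤ p − 1`
  have hnotG : ¬ TypeGOrd W₀ p := by
    intro hG
    have hS : SubGord W₀ p := (subGord_iff_typeG_of_addv W₀ p hp2 hadd₀).mpr hG.typeG
    obtain ⟨-, -, hdvd⟩ := hS
    unfold semistabilityIndex at hdvd
    rcases hcell with ⟨rfl, h⟩ | ⟨rfl, h⟩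
    · rw [hv₀, h] at hdvd
      norm_num at hdvd
    · rw [hv₀, h] at hdvd
      norm_num at hdvd
  -- (U) on `(W₀, D₀)`: `ord_p Δ_min(W₀) ≤ 4` — contradiction
  have hred₀ : ¬ W₀.HasIrreducibleModPGaloisRep p := fun h ↦
    not_hasIrreducibleModPGaloisRep_of_isIsogenous htw hred
      ((hasIrreducibleModPGaloisRep_quadraticTwist_iff W₀ hd0 p).mpr h)
  have hle := hU hnf W₀ D₀ hD₀ p hp h57 hpN₀
    (oddTwistMinimal_of_isIsogenous_twist_pStar hnf hp2 htw hpN hNN hodd)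
    (dyadicTwistMinimal_of_isIsogenous_twist_pStar hp2 htw hNN hdy)
    hred₀ (by rw [hNN]; exact hN) hI₀ hnotG
  rcases hcell with ⟨-, h⟩ | ⟨-, h⟩ <;> omega

/-- **E-imc-5 at 5 and 7 ∧ Gealy–Klagsbrun ⟹ on the K15b rows the ramified twist `W ⊗ p*` has no `X₀`-optimal globally minimal
model** — the preceding theorem fed with the width seat's υ (`optimalUnstarredNonGord57_of_acrossIsogeny_of_gealyKlagsbrun`,
p626338): the line's orientation law BY NAME (`Rank1Residual.ManinAdditive.OptimalUnstarredAcrossIsogeny`, the planner-of-record's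
registered conjecture) plus one cite-only printed fact. With the an-cell's PROVED trichotomy this puts every optimal `χ_{p*}`-orbit
through a K15b row in the FLIP case (`deg φ̃ = deg φ`), where Edixhoven's printed §4 dichotomy does not apply. Conditional result;
closes nothing. [cite: GealyKlagsbrun2017, Thm. 1] [cite: Stevens1989, §2] [cite: EdixhovenManin1991, §4] -/
theorem ssRow_smul_twist_ne_optimal_of_acrossIsogeny
    (hGK : gealyKlagsbrun2017_neronScalar_of_additive_potSupersingular)
    (hE5 : OptimalUnstarredAcrossIsogeny 5) (hE7 : OptimalUnstarredAcrossIsogeny 7) :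
    exists_isNewformOf →
    ∀ (W : WeierstrassCurve ℚ) [W.IsElliptic] [W.IsGloballyMinimal] (p : ℕ) (hp : p.Prime),
      (p = 5 ∨ p = 7) → p ^ 2 ∣ W.conductorNorm ℤ →
      ¬ (∃ (W' : WeierstrassCurve ℚ) (q : ℕ), W'.IsElliptic ∧ W'.IsGloballyMinimal ∧ q.Prime ∧
          q ≠ 2 ∧ q ^ 2 ∣ W.conductorNorm ℤ ∧
          IsIsogenous W (W'.quadraticTwist (((-1 : ℤ) ^ (q / 2) * q : ℤ) : ℚ)) ∧
          ¬ q ^ 2 ∣ W'.conductorNorm ℤ) →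
      ¬ (∃ (W' : WeierstrassCurve ℚ) (d : ℤ), W'.IsElliptic ∧ W'.IsGloballyMinimal ∧
          (d = -1 ∨ d = 2 ∨ d = -2) ∧ 2 ^ 2 ∣ W.conductorNorm ℤ ∧
          IsIsogenous W (W'.quadraticTwist (d : ℚ)) ∧ ¬ 2 ^ 2 ∣ W'.conductorNorm ℤ) →
      ¬ W.HasIrreducibleModPGaloisRep p →
      500000 < W.conductorNorm ℤ →
      (∀ n : ℕ, W.kodairaSymbolAt ((Rat.HeightOneSpectrum.primesEquiv (R := ℤ)).symm ⟨p, hp⟩) ≠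
        .Istar n) →
      ((p = 5 ∧ padicValInt p W.minimalDiscriminantInt = 4) ∨
        (p = 7 ∧ padicValInt p W.minimalDiscriminantInt = 3)) →
      ∀ (W₀ : WeierstrassCurve ℚ) [W₀.IsElliptic] [W₀.IsGloballyMinimal] [NeZero (W₀.conductorNorm ℤ)]
        (D₀ : ModularParametrizationData W₀ (W₀.conductorNorm ℤ)), IsLatticeOptimal D₀ →
        ∀ u : VariableChange ℚ, u • W.quadraticTwist ((((-1 : ℤ) ^ (p / 2) * p : ℤ)) : ℚ) ≠ W₀ :=
  ssRow_smul_twist_ne_optimal_of_optimalUnstarredNonGord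
    (optimalUnstarredNonGord57_of_acrossIsogeny_of_gealyKlagsbrun hGK hE5 hE7)

end Summit.BirchSwinnertonDyer.BirchSwinnertonDyer.Theorems

end
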